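/-
Copyright (c) 2026 the pub-hodgecm-mathlib formalisation cell (harness21).  Prover seat hodgecm-mathlib-R90-C133-p03 (g3), Track B ∕ K2-LIT ∕ R90-TF section S5
(Rogawski Ch. 13.3 ∕ §14.6); deal (H23) R90-C133-plan (g3) 2026-09-05T02:45:28Z ∕ 02:47:20Z: the (β) letter of the `₃` road AT THE RECORD OCCURRENCE PREDICATE, BY VALUE.
-/
import Summits.HodgeConjecture.HodgeConjecture.Theorems.R90S5EvpTransportAe   -- ★ p864229 (R90-C133-p01 (g2)) (T2) `exists_ae_liftsTo_rhoXiU_of_mem_occ` (over ★ p864086 `ae_liftsTo_of_mem_occ`, ★ W3, ★ W1 `rhoXiU`)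
import Summits.HodgeConjecture.HodgeConjecture.Theorems.R90S5OccGOfRecord      -- ★ p864324 (this seat) `R90.S5.OccGOfRecord L ι μ π c` (occurrence on `U(Φ₃)` with a coh-unitary token of class `c` at `ι`), ★ `archDegOneClass`
import HarnessLib

/-!
# R90-TF · S5 — `R90S5QsArchJExhaustionAtRecord`: the (β) letter «ARCH-J EXHAUSTION ON THE QUASI-SPLIT GROUP, A.E. FORM» at the RECORD occurrence predicate
# ★ `OccGOfRecord L ι μqs · (archDegOneClass δ hδ)`, BY VALUE, modulo its three named rows (Rogawski 1990, Thm. 13.3.6 (c) at `ι`; §13.10; Prop. 13.1.3 (d))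

Cell `hodgecm-mathlib`, crux H413 = `stmt-HodgeConjecture-24833`, route `HCCMUnconditional`; R90-TF section S5 (R90-C133); deal (H23).  PROOF lane (one theorem +
one reading; no `def`, no instance, no notation, no `sorry`; ★-only imports — L9: no `Lines` import); `--supports stmt-HodgeConjecture-24833 --as helper`.

WHAT.  The S5-OWNED letter (β) of the `₃` road — S5-A3 ED. 1 `QsArchJExhaustionLetter₃At L ι 𝔩 h8U 𝔞 μqs Pk` (`Cruxes/H413/Lines/R90_S5_ArchJLettersA3.lean` :142,
RULINGS S5-R13 (1) «AE-CUT» ∕ S5-R18″) — reads, at a frame `(𝔩, h8U, 𝔞, μqs, Pk)` over `Φ₃ = splitForm L 3`: «a packet of record `Q` with a member family `π ∈ Q_f` OCCURRING on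
`U(Φ₃)` through a discrete `P′` carrying a coh-unitary `(𝔤, K)`-token of class `[J^δ]` at `ι` (★ `OccGOfRecord`) is ALMOST EVERYWHERE the A-packet `Π(ξ′) = ξ_H((rhoXiU h8U ξ′)_v)_v`
of SOME one-dimensional automorphic `ξ′`».  This module files that statement BY VALUE over ★ `SpectralPacketG 𝔩 𝔞 μqs` (the Lines-side `PacketGOfRecord` is its subtype; a
`Theorems` module imports no `Lines` module, so neither A3's name nor S4-A's kit of record `rogawskiLocalKit` nor C2's `PacketGOfRecord` is mentioned — the Lines-side payer
applies the theorem to `Q.1` at `𝔩 v := R90.S4.rogawskiLocalKit L v μω …` and closes (β) by `exact`, as the HOME probe `R90/R90-C133-p03/g3/h19/ProbeA3RecordFrame…lean` §H19b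
`sockBetaRec_of_rows` certifies), as the SPECIALISATION of ★ p864229 (T2) `exists_ae_liftsTo_rhoXiU_of_mem_occ` to `Occ := R90.S5.OccGOfRecord L ι μqs`, `j := archDegOneClass δ hδ`,
with the THREE ROWS named at that occurrence predicate and nothing else:
* `h1336cArch` — «13.3.6 (c) WITH THE TRIGGER AT `ι`»: a family occurring with the `[J^δ]` token lies, place by place, in the kit's image `ξ_H(σ_v)` of a character packet `σ` of some
  one-dimensional `ξ′` [Thm. 13.3.6 (c) p. 202; §13.10 p. 230] — paid D-side: S5-D ED. 5 §5 `stub_R90_1336c_qsArchMembership` (a theorem over the rows (r12) `hNArch` [S10-F] and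
  (r13) `hMult` [E1]) through ★ p864376 `archRow_h1336c_of_socket`;
* `hSph` — (ℓ-sphA) `SphXiHOneDimLaw` at every finite place [§13.1 p. 199 ¶2; §12.2] — S4 (JQ-S5→S4-10);
* `hDiscXi` — the character packet of a one-dimensional `ξ′` underlies a spectral `H`-packet [§13.1 Prop. 13.1.3 (d); §13.3 p. 201] — C2 ★ (`packetHOfOneDimU`);
* (ℓ8ᵁ) `h8U` only NAMES `rhoXiU`.
No Thm. 13.3.5, no archimedean packet slot (LAW NO-INF: `Q` is read through `Q.fin` only).  Proof: ONE `exact` of (T2).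
HONEST LABEL: a specialisation pays no socket — the rows are INPUTS; S5 ON-PATH code-sorries 4 ∕ OFF-PATH 1 unchanged; HC_CM is proved only modulo the 7 printed citations
(2 remaining named inputs: hLiu418 = stmt-HodgeConjecture-24832, h413 = stmt-HodgeConjecture-24833) until rung 0 closes.

## References
* [Rogawski1990] J. D. Rogawski, *Automorphic Representations of Unitary Groups in Three Variables*, Ann. of Math. Stud. 123 (1990): §13.3 Thm. 13.3.3 (c), Thm. 13.3.6 (c)
  p. 202, p. 201 ll. 10–18; §13.10 p. 230; §13.1 p. 199 ¶2, Prop. 13.1.3 (d); §12.3 p. 178; §14.6 Prop. 14.6.2 pp. 242–243.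
-/

set_option autoImplicit false
set_option linter.dupNamespace false -- the mandated namespace repeats `HodgeConjecture.HodgeConjecture`, as in every sibling `R90S5*` file

noncomputable section

open NumberField IsDedekindDomain MeasureTheory Filter
open scoped Matrix
open Literature.NumberTheory Literature.NumberTheory.Automorphic Literature.NumberTheory.Automorphic.UnitaryGroup
open Literature.NumberTheory.Rogawski1990
open Literature.RepresentationTheory Literature.RepresentationTheory.BorelWallach2000 Literature.RepresentationTheory.KonnoKonno2007

namespace Summit.HodgeConjecture.HodgeConjecture.R90.S5

open Summit.HodgeConjecture.HodgeConjecture.Cruxes.H413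
open Summit.HodgeConjecture.HodgeConjecture.Cruxes.H413.F0P3LocalPacketKit
open Summit.HodgeConjecture.HodgeConjecture.Cruxes.H413.F0P3GlobalPacket
open Summit.HodgeConjecture.HodgeConjecture.Cruxes.H413.F0P3ArchPacketKit
open Summit.HodgeConjecture.HodgeConjecture.Cruxes.H413.F0P3SpectralPacket
open Summit.HodgeConjecture.HodgeConjecture.Cruxes.H413.F0P3InnerFormClassificationV6 (splitForm)
open Summit.HodgeConjecture.HodgeConjecture.Cruxes.H413.F0P3bArchDegOneClass (archDegOneClass)

section AtRecord

variable (L : Type) [Field L] [NumberField L] [IsCMField L] (ι : L →+* ℂ)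
  {𝔩 : ∀ v : HeightOneSpectrum (𝓞 ↥(maximalRealSubfield L)), LocalPacketKit L (splitForm L 3) v} {𝔞 : ArchPacketKit} {𝔞H : ArchPacketKitH 𝔞}
  {DiscH : GlobalPacketH 𝔩 → 𝔞H.PktInfH → Prop}
  (μqs : Measure (adelicGroupData (↥(maximalRealSubfield L)) L (IsCMField.complexConj L) 3 (splitForm L 3)).automorphicQuotient)
  [(adelicGroupData (↥(maximalRealSubfield L)) L (IsCMField.complexConj L) 3 (splitForm L 3)).IsAutomorphicMeasure μqs]
  (h1336cArch : ∀ (δ : ℤ) (hδ : δ = 1 ∨ δ = -1)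
    (π : ∀ v : HeightOneSpectrum (𝓞 ↥(maximalRealSubfield L)), IrrClass ((cmDatum L 3 (splitForm L 3)).Local v)),
    OccGOfRecord L ι μqs π (archDegOneClass δ hδ) →
      ∃ σ : GlobalPacketH 𝔩,
        (∃ ξ' : OneDimAutRepH L, σ.IsCharPacket (fun v => ξ'.xiLocalChar v) (fun v => F0P3XiLocalCharOpenKernel.isOpen_ker_xiLocalChar L ξ' v)) ∧
          ∀ v : HeightOneSpectrum (𝓞 ↥(maximalRealSubfield L)), π v ∈ (𝔩 v).mem ((𝔩 v).xiH (σ.loc v)))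
  (hSph : ∀ v : HeightOneSpectrum (𝓞 ↥(maximalRealSubfield L)), (𝔩 v).SphXiHOneDimLaw)
  (hDiscXi : ∀ σ : GlobalPacketH 𝔩,
    (∃ ξ' : OneDimAutRepH L, σ.IsCharPacket (fun v => ξ'.xiLocalChar v) (fun v => F0P3XiLocalCharOpenKernel.isOpen_ker_xiLocalChar L ξ' v)) →
      ∃ ρ : SpectralPacketH 𝔩 𝔞 𝔞H DiscH, ρ.fin = σ)
  (h8U : ∀ v : HeightOneSpectrum (𝓞 ↥(maximalRealSubfield L)), (𝔩 v).OneDimHLawU)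

include h1336cArch hSph hDiscXi

/-- **THE (β) LETTER AT THE RECORD OCCURRENCE PREDICATE, BY VALUE, MODULO ITS THREE ROWS** (= S5-A3 `QsArchJExhaustionLetter₃At L ι 𝔩 h8U 𝔞 μqs Pk`'s body over
★ `SpectralPacketG`; ★ p864229 (T2) at `Occ := OccGOfRecord L ι μqs`, `j := archDegOneClass δ hδ`): for every automorphic measure `μqs` of `U(Φ₃)`, every frame `(𝔩, h8U, 𝔞)`,
and every sign `δ = ±1`, a discrete `G`-packet `Q` one of whose member families `π ∈ Q_f` OCCURS on `U(Φ₃)` through a discrete `P′` carrying a coh-unitary token of class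
`[J^δ]` at `ι` (★ `OccGOfRecord`) satisfies `Q_v = ξ_H((rhoXiU h8U ξ′)_v)` for almost all finite `v`, for SOME one-dimensional automorphic `ξ′` — given the rows
`h1336cArch` [13.3.6 (c) at `ι`; D ED. 5 §5 via ★ p864376], `hSph` [(ℓ-sphA); S4-10], `hDiscXi` [C2 ★].  One `exact`; no 13.3.5; `Q` read through `Q.fin` only.
[cite: Rogawski1990, §13.3 Thm. 13.3.6 (c) p. 202, p. 201 ll. 10–18; §13.10 p. 230; §13.1 p. 199 ¶2, Prop. 13.1.3 (d); §12.3 p. 178] -/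
theorem eventually_loc_eq_xiH_rhoXiU_of_mem_occGOfRecord (Q : SpectralPacketG 𝔩 𝔞 μqs) (δ : ℤ) (hδ : δ = 1 ∨ δ = -1)
    (hOcc : ∃ π : ∀ v : HeightOneSpectrum (𝓞 ↥(maximalRealSubfield L)), IrrClass ((cmDatum L 3 (splitForm L 3)).Local v),
      Q.fin.Mem π ∧ OccGOfRecord L ι μqs π (archDegOneClass δ hδ)) :
    ∃ ξ' : OneDimAutRepH L, ∀ᶠ v : HeightOneSpectrum (𝓞 ↥(maximalRealSubfield L)) in cofinite,
      Q.fin.loc v = (𝔩 v).xiH ((GlobalPacketH.rhoXiU h8U ξ').loc v) :=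
  exists_ae_liftsTo_rhoXiU_of_mem_occ L (OccGOfRecord L ι μqs) (archDegOneClass δ hδ) (h1336cArch δ hδ) hSph hDiscXi h8U Q hOcc

/-- **THE SAME, IN THE (β)At BINDER ORDER** (`∀ (Q) (δ) (hδ), ‹occurring member› → ∃ ξ′, ∀ᶠ v, …` — the body of S5-A3 `QsArchJExhaustionLetter₃At L ι 𝔩 h8U 𝔞 μqs Pk` read at
`Q.1` for `Q : PacketGOfRecord 𝔩 𝔞 μqs Pk`; the Lines-side payer is `fun Q δ hδ h => this … Q.1 δ hδ h`). [cite: Rogawski1990, §13.3 Thm. 13.3.6 (c) p. 202; §13.10 p. 230] -/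
theorem forall_eventually_loc_eq_xiH_rhoXiU_of_mem_occGOfRecord :
    ∀ (Q : SpectralPacketG 𝔩 𝔞 μqs) (δ : ℤ) (hδ : δ = 1 ∨ δ = -1),
      (∃ π : ∀ v : HeightOneSpectrum (𝓞 ↥(maximalRealSubfield L)), IrrClass ((cmDatum L 3 (splitForm L 3)).Local v),
          Q.fin.Mem π ∧ OccGOfRecord L ι μqs π (archDegOneClass δ hδ)) →
        ∃ ξ' : OneDimAutRepH L, ∀ᶠ v : HeightOneSpectrum (𝓞 ↥(maximalRealSubfield L)) in cofinite,
          Q.fin.loc v = (𝔩 v).xiH ((GlobalPacketH.rhoXiU h8U ξ').loc v) :=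
  fun Q δ hδ hOcc => eventually_loc_eq_xiH_rhoXiU_of_mem_occGOfRecord L ι μqs h1336cArch hSph hDiscXi h8U Q δ hδ hOcc

end AtRecord

end Summit.HodgeConjecture.HodgeConjecture.R90.S5

end
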